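import Literature.MathematicalPhysics.QuantumFieldTheory.Balaban1983to89.B2Ineq335Printed

/-!
# `Balaban1983to89.B2Ineq340VectorFields` — T. Bałaban, *(Higgs)₂,₃ quantum fields in a finite volume. II. An upper
bound*, Commun. Math. Phys. **86** (1982) 555–594 [Balaban1982Higgs2], §3.B pp. 591–592: **(3.40)–(3.41)** — the
VECTOR-FIELD analogue of (3.22) ⇒ (3.35) (*"The expression we get can be estimated in a way similar to (3.22). Now it
is even simpler because we do not need the characteristic functions, as it was noticed in Proposition 3.1"*) PROVED
SCHEMATICALLY with the mechanism of `B2Ineq335Exceptions.rhs322_le`: the pointwise step with bond AND site (mass)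
restrictions `χᶜ_{Q_v}`, `χᶜ_{R_v}` from the zero-field Prop. 3.1 (§1), the vector-field integral bounded by
`∫dΦ_v Z_v e^{−¼⟨Φ_v,Δ_vΦ_v⟩}·Π_kζ″_{Λ₀⁽ᵏ⁾}` with **ζ″ = (3.41)** (§2), and the bookkeeping (3.21) + (3.39) + (2.118)
⇒ (3.40) with the printed `O(1)`'s explicit (§3)

statement-level skeleton of published theorems with citation tags; proofs where landed; nothing here is a claim about the Yang–Mills mass gap

CITATION HEADER.  PDF held `paper:balaban1982-cmp86-higgs23-ii` (journal page = PDF page + 554); pp. 588–592 READ AS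
IMAGES on the ×2 renders `run/shared/lean/pub/pub-balaban/b2b-balaban-ref1/pages/1982-cmp86-higgs23-II/1982-cmp86-higgs23-II-p034-x2.png`
… `-p038-x2.png`, (2.2) on `-p003-x2.png`.  Unit `lit-balaban-p15` gen 6 (Phase-2 proof seat p15; HOME
`run/shared/lean/pub/lit-balaban/`).  SKELETON row **B2.Eq3.32** ((3.30)–(3.41); fold owner r02, second readers r14/r13,
referee ref-4; head `proved p246000`): residue member **(3.40)** («absent — (3.40) (vector fields, "estimated in a way
similar to (3.22) … even simpler")», GAPS G-B2-07 (vi)); (3.41) ζ″ is typed with body by r14 g3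
(`B2Eq341Zeta.zeta341`).  USED BY NAME: this seat's `B2Ineq335Exceptions.rhs322_le` (file 1/2 of (3.35): the
integration-with-exceptions mechanism) and `B2Ineq335Printed.excLevel` / `largeFieldSite` /
`lintegral_gaussLevel_mul_excLevel_printed_le` (file 2/2: (3.32)+(3.33) for a whole level), r14's
`B2Eq337LastIntegrations.gaussLevel`, `B2Sect3BSmallFactors.ineq330`.  Nothing restated.

THE SOURCE TEXT (verbatim, p. 591 l.−9 – p. 592 l.6 [PDF 37–38]).  *"Using the above inequality we estimate the right
side of (3.21) by an expression in which the curly bracket {…} is replaced by the right side of (3.39). The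
expression we get can be estimated in a way similar to (3.22). Now it is even simpler because we do not need the
characteristic functions, as it was noticed in Proposition 3.1. We get the inequality ∫dB∫dψ ρ^{(K),L^Kε}(Λ₀⁽⁰⁾, …,
Λ₀⁽ᴷ⁻¹⁾, B, B^{(K),ε}, ψ) ≦ Π_{k=0}^{K−1} ζ″_{Λ₀⁽ᵏ⁾} exp(E₀) exp(O(1)Σ_{k=1}^{K}|Λ_k|) exp(O(1)|T_ε|), (3.40) where ζ″_{Λ₀⁽ᵏ⁾} =
Σ_{{P_v⁽ᵏ⁾,…,R_s⁽ᵏ⁾} admissible, minimal} exp(−⅛ap(Lᵏε)²|P_v⁽ᵏ⁾|)exp(−¼γ₀p(Lᵏε)²|Q_v⁽ᵏ⁾|)·exp(−¼γ₀p(Lᵏε)²|R_v⁽ᵏ⁾|)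
exp(−⅛ap(Lᵏε)²|P_s⁽ᵏ⁾|)·exp(−¼γ₀p(Lᵏε)²|Q_s⁽ᵏ⁾|)exp(−p(Lᵏε)²|R_s⁽ᵏ⁾|). (3.41)"*  (3.21) p. 588: *"∫dA_K∫dφ_K ρ^{(K),L^Kε}(…)
≦ ∫dA_Kχ_{K,v}T^{L^{K−1}ε}_{a,L}[χ_{K−1,Λ₅⁽ᴷ⁻¹⁾ᶜ,v}χ_{Λ₋₁⁽ᴷ⁻¹⁾∩Λ₅⁽ᴷ⁻¹⁾ᶜ,v} ⋯ T^ε_{a,L}[χ_{Λ₋₁⁽⁰⁾∩Λ₅⁽⁰⁾ᶜ,v} exp(−½⟨A₀, (−Δ^ε +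
μ₀²)A₀⟩){…}]…] exp(Σ_{k=1}^{K}O(1)(Lᵏε)^{κ₀}|T_ε|)"*; Prop. 3.1 p. 589: *"If Ã^ε = 0, then the inequality holds without
the last sum on the right side and without any restrictions on the configuration Φ"*; (2.2) p. 557 (the vector-field
restrictions): *"|B(y) − (QA)(y)| > p(ε), |(∂A)(b)| > p(ε), |A(x)| > p(ε)/(μ₀ε)"* (↦ P_v, Q_v, R_v); (2.118) p. 582:
*"Σ_{j=0}^{K−1}O((Lʲε)^κ)|T₁^{(j)}| = Σ_{j=0}^{K−1}O(1)(Lʲε)^{κ₀}|T_ε| ≦ O(1)|T_ε|"*.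

THE MODEL (schematic; as file 1/2 of (3.35), now read for the vector fields).  After the replacement `{…} ≤ (3.39)`
and the compositions *"similar to (3.22)"*, the vector-field integrand has the shape `integrand322` of
`B2Ineq335Exceptions`: kept variables `Φ_v` (level 0; `F = Z_ve^{−½X}` ↤ the vector-field (3.25), no background
field), output fields `A_{j+1}↾` (level j+1) produced by the Gaussian kernels `gaussLevel` of precision `a(Lʲε)^{d−2}`
with centres `(QA_j)(y)` (linear averages), the other characteristic functions `b ∈ [0,1]` (↤ `χ_{K,v}`,
`χ_{k,Λ₅⁽ᵏ⁾ᶜ,v}`, `χ_{Λ₋₁⁽ᵏ⁾∩Λ₅⁽ᵏ⁾ᶜ,v}`), and per level the families `τ` of ζ′ (3.34): weights `w_{j,τ}` ↤ the SCALAR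
small factors `e^{−⅛ap²|P_s|}e^{−¼γ₀p²|Q_s|}e^{−p²|R_s|}` of (3.34) (constants now), `q_{j,τ}` ↤ `χᶜ_{Q_v⁽ʲ⁾}χᶜ_{R_v⁽ʲ⁾}`
(bond restriction `|(∂A)(b)| > p` and site restriction `|A(x)| > p/(μ₀ε)` on the kept variables — the bond resp. mass
terms of (3.26)), `e_{j,τ}` ↤ `χᶜ_{P_v⁽ʲ⁾}` (the printed large-field indicator on the output field, `largeFieldSite`).
Prop. 3.1 at zero field: `X ≥ Σ_{k≤K}γ₀(Σ_b t_{k,b} + Σ_x m_{k,x})` with NO error terms and NO restriction (the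
theorems keep a general `E` and the "on the support of `b`" form; zero field is `E ≡ 0`, `h326` unconditional).

WHAT IS PROVED (kernel-checked, 0 `sorry`, standard axioms).
§1 **`ineq331_QR`** ((3.31) with bond AND site restrictions: `χχ′e^{−¼T} ≤ e^{−¼γ₀r|Q|}e^{−¼γ₀r′|R|}e^{¼E}`),
   `prod_chiQR_mul_exp_le` (multiplied over the levels, top level bare), **`pointwise340`** (Prop. 3.1 on the support
   of `b` + (3.30) `ineq330` + (3.31)_QR + `b ≤ 1` ⇒ the pointwise hypothesis of `rhs322_le`).
§2 **`ineq340_core`**: `(3.22)_v ≤ e^{¼ΣE_k}·∫dΦ Z e^{−¼X(Φ)}·Π_{j<K}Σ_τ w_{j,τ}·e^{−¼γ₀r_j|Q_v⁽ʲ⁾(τ)|}e^{−¼γ₀r′_j|R_v⁽ʲ⁾(τ)|}·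
   (e^{−⅛ar_j})^{|P_v⁽ʲ⁾(τ)|}` — with `w` the scalar factors of (3.34) and `r_j = r′_j = p(Lʲε)²` the level factor is
   EXACTLY **ζ″_{Λ₀⁽ʲ⁾} of (3.41)**; all structural hypotheses of `rhs322_le` discharged (`B2Ineq335Printed.ineq335` is the
   special case without site restrictions).
§3 **`ineq340_of_321_339`** ((3.40) AS BOOKKEEPING in the reals of one cutoff, r14's (3.39) style: (3.21) `lhs ≤
   I_v e^{s₂₁}`, (2.118) `s₂₁ ≤ C₁|T_ε|`, (3.39) under the vector-field integral `I_v ≤ e^{E_{0,s}}e^{c₃₉Σ_{k=0}^{K}|Λ_k|}J_v`,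
   §2 `J_v ≤ I₄·Πζ″`, (3.36)–(3.38) for the vector fields `I₄ = e^{c₂Σ_{k=0}^{K}|Λ_k|}e^{E_{0,v}}` (an equality at zero
   field: Jacobian + free Gaussian integral), `|Λ₀| = |Λ₅⁽⁰⁾ᶜ| ≤ |T_ε|` ⇒ `lhs ≤ Πζ″·e^{E_{0,s}+E_{0,v}}·
   e^{(c₃₉+c₂)Σ_{k=1}^{K}|Λ_k|}·e^{(C₁+|c₃₉|+|c₂|)|T_ε|}` = (3.40) with `E₀ = E_{0,s} + E_{0,v}` and both `O(1)` explicit).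
HONEST SCOPE.  (i) SCHEMATIC as files 1/2–2/2 of (3.35) and r14's (3.37): the vector-field compositions *"similar to
(3.22)"* ((3.21) → the (3.22)-shape) are the dictionary, not constructed; §3's inputs (3.21), (3.39)-under-the-integral,
(3.36)–(3.38)_v are real-number hypotheses in printed shape (their kernels: r14's `eq336`, `lmarginal_gaussLevels_eq`;
p28's `B2Ineq338Diamagnetic` is not needed at zero field).  (ii) `E₀ = E_{0,s} + E_{0,v}` is this file's reading of
the print's `exp(E₀)` in (3.40) next to `exp(E_{0,s})` in (3.39) (E₀ = the normalization of part I (1.13)); the k = 0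
volume `|Λ₅⁽⁰⁾ᶜ|` of (3.39)'s `Σ_{k=0}^{K}` is absorbed into `exp(O(1)|T_ε|)`, which is why (3.40) sums from k = 1.
(iii) No concrete carrier.  Value = kernel certificate of the published step in schematic coordinates; NOT summit
progress.
-/

noncomputable section

namespace Literature.MathematicalPhysics.QuantumFieldTheory.Balaban1983to89.B2Ineq340VectorFields

open MeasureTheory Finset Function
open scoped ENNReal
open B2Eq337LastIntegrations (chainDensity gaussLevel)
open B2Ineq335Exceptions B2Ineq335Printed

/-! ## §1  The pointwise step for the vector fields: (3.31) with bond AND site restrictions, zero-field Prop. 3.1 -/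

section Pointwise

/-- **(3.31) FOR THE VECTOR FIELDS** (p. 591 l.−2: ζ″ *"is obtained from ζ′ by applying the equality (3.32) and the
inequalities (3.31), (3.33) for vector fields"*), KERNEL: the k-th term of the right side of (3.26) written with its
mass part site by site, `T = γ₀(Σ_{b∈Bk} t_b + Σ_{x∈St} m_x) − E` (`t, m ≥ 0`); the values `χ, χ′ ∈ {0,1}` of
`χᶜ_{Q_v⁽ᵏ⁾}` (`= 1` forces `t_b > r` on `Q ⊆ Bk`: `|(∂A)(b)| > p` of (2.2)) and of `χᶜ_{R_v⁽ᵏ⁾}` (`= 1` forces `m_x > r′`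
on `R ⊆ St`: `|A(x)| > p/(μ₀ε)` of (2.2), i.e. the mass term is large): `χχ′e^{−¼T} ≤ e^{−¼γ₀r|Q|}e^{−¼γ₀r′|R|}e^{¼E}`.
[cite: Balaban1982Higgs2, (3.31) p.590, (3.41) p.592, (2.2) p.557] -/
theorem ineq331_QR {Bnd St : Type*} (Bk Q : Finset Bnd) (hQ : Q ⊆ Bk) (Ss R : Finset St) (hR : R ⊆ Ss)
    (t : Bnd → ℝ) (m : St → ℝ) (ht : ∀ b ∈ Bk, 0 ≤ t b) (hm : ∀ x ∈ Ss, 0 ≤ m x)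
    {γ₀ E r r' χ χ' : ℝ} (hγ : 0 ≤ γ₀) (hχ : χ = 0 ∨ χ = 1) (hχ' : χ' = 0 ∨ χ' = 1)
    (hlarge : χ = 1 → ∀ b ∈ Q, r < t b) (hlarge' : χ' = 1 → ∀ x ∈ R, r' < m x) :
    χ * χ' * Real.exp (-((γ₀ * (∑ b ∈ Bk, t b + ∑ x ∈ Ss, m x) - E) / 4))
      ≤ Real.exp (-(γ₀ * r * Q.card / 4)) * Real.exp (-(γ₀ * r' * R.card / 4)) * Real.exp (E / 4) := by
  rcases hχ with h0 | h1
  · rw [h0, zero_mul, zero_mul]; positivity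
  rcases hχ' with h0' | h1'
  · rw [h0', mul_zero, zero_mul]; positivity
  rw [h1, h1', one_mul, one_mul, ← Real.exp_add, ← Real.exp_add]
  refine Real.exp_le_exp.2 ?_
  have hQsum : r * Q.card ≤ ∑ b ∈ Bk, t b := by
    calc r * Q.card = ∑ _b ∈ Q, r := by rw [Finset.sum_const, nsmul_eq_mul, mul_comm]
      _ ≤ ∑ b ∈ Q, t b := Finset.sum_le_sum fun b hb => (hlarge h1 b hb).le
      _ ≤ ∑ b ∈ Bk, t b := Finset.sum_le_sum_of_subset_of_nonneg hQ fun b hb _ => ht b hb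
  have hRsum : r' * R.card ≤ ∑ x ∈ Ss, m x := by
    calc r' * R.card = ∑ _x ∈ R, r' := by rw [Finset.sum_const, nsmul_eq_mul, mul_comm]
      _ ≤ ∑ x ∈ R, m x := Finset.sum_le_sum fun x hx => (hlarge' h1' x hx).le
      _ ≤ ∑ x ∈ Ss, m x := Finset.sum_le_sum_of_subset_of_nonneg hR fun x hx _ => hm x hx
  have : γ₀ * (r * Q.card + r' * R.card) ≤ γ₀ * (∑ b ∈ Bk, t b + ∑ x ∈ Ss, m x) :=
    mul_le_mul_of_nonneg_left (add_le_add hQsum hRsum) hγ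
  nlinarith

/-- **(3.30) + (3.31) FOR THE VECTOR FIELDS, MULTIPLIED OVER THE LEVELS** (reals): with `T_k = γ₀(Σ_{b∈Bk_k}t_{k,b} +
Σ_{x∈St_k}m_{k,x}) − E_k` and, for the levels `j < K` carrying a family, the values `χ_j, χ′_j ∈ {0,1}` of
`χᶜ_{Q_v⁽ʲ⁾}`, `χᶜ_{R_v⁽ʲ⁾}`: `(Π_{j<K}χ_jχ′_j)·e^{−¼Σ_{k≤K}T_k} ≤ (Π_{j<K}e^{−¼γ₀r_j|Q⁽ʲ⁾|}e^{−¼γ₀r′_j|R⁽ʲ⁾|})·e^{¼Σ_{k≤K}E_k}`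
(at zero field Prop. 3.1 has no error terms: `E ≡ 0`). [cite: Balaban1982Higgs2, (3.26) p.589, (3.30)–(3.31) p.590, (3.41) p.592] -/
theorem prod_chiQR_mul_exp_le {Bnd St : Type*} {K : ℕ} (Bk : ℕ → Finset Bnd) (Ss : ℕ → Finset St)
    (t : ℕ → Bnd → ℝ) (m : ℕ → St → ℝ) (ht : ∀ j, ∀ b ∈ Bk j, 0 ≤ t j b) (hm : ∀ j, ∀ x ∈ Ss j, 0 ≤ m j x)
    (E : ℕ → ℝ) {γ₀ : ℝ} (hγ : 0 ≤ γ₀) (r r' : ℕ → ℝ)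
    (Q : Fin K → Finset Bnd) (hQ : ∀ j, Q j ⊆ Bk j) (R : Fin K → Finset St) (hR : ∀ j, R j ⊆ Ss j)
    (χ χ' : Fin K → ℝ) (hχ : ∀ j, χ j = 0 ∨ χ j = 1) (hχ' : ∀ j, χ' j = 0 ∨ χ' j = 1)
    (hlarge : ∀ j, χ j = 1 → ∀ b ∈ Q j, r j < t j b) (hlarge' : ∀ j, χ' j = 1 → ∀ x ∈ R j, r' j < m j x) :
    (∏ j : Fin K, χ j * χ' j)
        * Real.exp (-((∑ j ∈ range (K + 1), (γ₀ * (∑ b ∈ Bk j, t j b + ∑ x ∈ Ss j, m j x) - E j)) / 4))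
      ≤ (∏ j : Fin K, Real.exp (-(γ₀ * r j * (Q j).card / 4)) * Real.exp (-(γ₀ * r' j * (R j).card / 4)))
          * Real.exp ((∑ j ∈ range (K + 1), E j) / 4) := by
  set T : ℕ → ℝ := fun j => γ₀ * (∑ b ∈ Bk j, t j b + ∑ x ∈ Ss j, m j x) - E j with hT
  have hsplit : Real.exp (-((∑ j ∈ range (K + 1), T j) / 4))
      = (∏ j : Fin K, Real.exp (-(T j / 4))) * Real.exp (-(T K / 4)) := by
    have : -((∑ j ∈ range (K + 1), T j) / 4) = ∑ j ∈ range (K + 1), (-(T j / 4)) := by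
      rw [Finset.sum_div, ← Finset.sum_neg_distrib]
    rw [this, Real.exp_sum, Finset.prod_range_succ,
      ← Fin.prod_univ_eq_prod_range (fun j => Real.exp (-(T j / 4))) K]
  change (∏ j : Fin K, χ j * χ' j) * Real.exp (-((∑ j ∈ range (K + 1), T j) / 4)) ≤ _
  rw [hsplit, ← mul_assoc, ← Finset.prod_mul_distrib]
  have hj : ∀ j : Fin K, χ j * χ' j * Real.exp (-(T j / 4))
      ≤ (Real.exp (-(γ₀ * r j * (Q j).card / 4)) * Real.exp (-(γ₀ * r' j * (R j).card / 4)))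
          * Real.exp (E j / 4) :=
    fun j => ineq331_QR (Bk j) (Q j) (hQ j) (Ss j) (R j) (hR j) (t j) (m j) (ht j) (hm j) hγ (hχ j) (hχ' j)
      (hlarge j) (hlarge' j)
  have hK : Real.exp (-(T K / 4)) ≤ Real.exp (E K / 4) := by
    refine Real.exp_le_exp.2 ?_
    have : 0 ≤ γ₀ * (∑ b ∈ Bk K, t K b + ∑ x ∈ Ss K, m K x) :=
      mul_nonneg hγ (add_nonneg (Finset.sum_nonneg (ht K)) (Finset.sum_nonneg (hm K)))
    simp only [hT]
    linarith
  have hχ0 : ∀ j, 0 ≤ χ j * χ' j := fun j => by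
    rcases hχ j with h | h <;> rcases hχ' j with h' | h' <;> norm_num [h, h']
  calc (∏ j : Fin K, χ j * χ' j * Real.exp (-(T j / 4))) * Real.exp (-(T K / 4))
      ≤ (∏ j : Fin K, (Real.exp (-(γ₀ * r j * (Q j).card / 4)) * Real.exp (-(γ₀ * r' j * (R j).card / 4)))
          * Real.exp (E j / 4)) * Real.exp (E K / 4) :=
        mul_le_mul (Finset.prod_le_prod (fun j _ => mul_nonneg (hχ0 j) (Real.exp_pos _).le) fun j _ => hj j)
          hK (Real.exp_pos _).le (Finset.prod_nonneg fun j _ => by positivity)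
    _ = _ := by
        rw [Finset.prod_mul_distrib, mul_assoc]
        congr 1
        rw [Finset.sum_div, Finset.sum_range_succ, Real.exp_add, Real.exp_sum,
          ← Fin.prod_univ_eq_prod_range (fun j => Real.exp (E j / 4)) K]

/-- **THE POINTWISE STEP FOR THE VECTOR FIELDS** in the shape consumed by `B2Ineq335Exceptions.rhs322_le`: Prop. 3.1
(3.26) `X ≥ Σ_{k≤K}T_k` on the support of the other characteristic functions `b ∈ [0,1]` (at zero field: everywhere, p.
589 *"If Ã^ε = 0, then the inequality holds without the last sum on the right side and without any restrictions on
the configuration Φ"*), (3.30) `Z e^{−½X} ≤ Z e^{−¼X}e^{−¼ΣT_k}` (r14's `ineq330`), (3.31) with bond and site restrictions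
level by level, `b ≤ 1`: `Z e^{−½X}·b·Π_j χᶜ_{Q_v⁽ʲ⁾}χᶜ_{R_v⁽ʲ⁾} ≤ e^{¼ΣE_k}·Z e^{−¼X}·Π_j e^{−¼γ₀r_j|Q⁽ʲ⁾|}e^{−¼γ₀r′_j|R⁽ʲ⁾|}`.
[cite: Balaban1982Higgs2, (3.26) p.589, (3.30)–(3.31) p.590, (3.40)–(3.41) pp.591–592] -/
theorem pointwise340 {Bnd St : Type*} {K : ℕ} (Bk : ℕ → Finset Bnd) (Ss : ℕ → Finset St)
    (t : ℕ → Bnd → ℝ) (m : ℕ → St → ℝ) (ht : ∀ j, ∀ b ∈ Bk j, 0 ≤ t j b) (hm : ∀ j, ∀ x ∈ Ss j, 0 ≤ m j x)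
    (E : ℕ → ℝ) {γ₀ : ℝ} (hγ : 0 ≤ γ₀) (r r' : ℕ → ℝ)
    (Q : Fin K → Finset Bnd) (hQ : ∀ j, Q j ⊆ Bk j) (R : Fin K → Finset St) (hR : ∀ j, R j ⊆ Ss j)
    (χ χ' : Fin K → ℝ) (hχ : ∀ j, χ j = 0 ∨ χ j = 1) (hχ' : ∀ j, χ' j = 0 ∨ χ' j = 1)
    (hlarge : ∀ j, χ j = 1 → ∀ b ∈ Q j, r j < t j b) (hlarge' : ∀ j, χ' j = 1 → ∀ x ∈ R j, r' j < m j x)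
    {Z X b : ℝ} (hZ : 0 ≤ Z) (hb : 0 ≤ b ∧ b ≤ 1)
    (h326 : b ≠ 0 → (∑ j ∈ range (K + 1), (γ₀ * (∑ bb ∈ Bk j, t j bb + ∑ x ∈ Ss j, m j x) - E j)) ≤ X) :
    ENNReal.ofReal (Z * Real.exp (-(X / 2))) * ENNReal.ofReal b
        * ∏ j : Fin K, ENNReal.ofReal (χ j * χ' j)
      ≤ ENNReal.ofReal (Real.exp ((∑ j ∈ range (K + 1), E j) / 4)) * ENNReal.ofReal (Z * Real.exp (-(X / 4)))
        * ∏ j : Fin K, ENNReal.ofReal (Real.exp (-(γ₀ * r j * (Q j).card / 4))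
            * Real.exp (-(γ₀ * r' j * (R j).card / 4))) := by
  by_cases hb0 : b = 0
  · rw [hb0, ENNReal.ofReal_zero, mul_zero, zero_mul]
    exact bot_le
  have hRR := h326 hb0
  have hχ0 : ∀ j, 0 ≤ χ j * χ' j := fun j => by
    rcases hχ j with h | h <;> rcases hχ' j with h' | h' <;> norm_num [h, h']
  have hb1 : ENNReal.ofReal b ≤ 1 := ENNReal.ofReal_le_one.2 hb.2
  calc ENNReal.ofReal (Z * Real.exp (-(X / 2))) * ENNReal.ofReal b * ∏ j : Fin K, ENNReal.ofReal (χ j * χ' j)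
      ≤ ENNReal.ofReal (Z * Real.exp (-(X / 2))) * 1 * ∏ j : Fin K, ENNReal.ofReal (χ j * χ' j) :=
        mul_le_mul' (mul_le_mul' le_rfl hb1) le_rfl
    _ = ENNReal.ofReal (Z * Real.exp (-(X / 2)) * ∏ j : Fin K, χ j * χ' j) := by
        rw [mul_one, ENNReal.ofReal_mul (mul_nonneg hZ (Real.exp_pos _).le),
          ENNReal.ofReal_prod_of_nonneg fun j _ => hχ0 j]
    _ ≤ ENNReal.ofReal (Real.exp ((∑ j ∈ range (K + 1), E j) / 4) * (Z * Real.exp (-(X / 4)))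
          * ∏ j : Fin K, Real.exp (-(γ₀ * r j * (Q j).card / 4))
              * Real.exp (-(γ₀ * r' j * (R j).card / 4))) := by
        refine ENNReal.ofReal_le_ofReal ?_
        have h330 := B2Sect3BSmallFactors.ineq330 hZ hRR
        have h331 := prod_chiQR_mul_exp_le Bk Ss t m ht hm E hγ r r' Q hQ R hR χ χ' hχ hχ' hlarge hlarge'
        have hP0 : 0 ≤ ∏ j : Fin K, χ j * χ' j := Finset.prod_nonneg fun j _ => hχ0 j
        calc Z * Real.exp (-(X / 2)) * ∏ j : Fin K, χ j * χ' j
            ≤ (Z * Real.exp (-(X / 4)) * Real.exp (-((∑ j ∈ range (K + 1),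
                (γ₀ * (∑ bb ∈ Bk j, t j bb + ∑ x ∈ Ss j, m j x) - E j)) / 4))) * ∏ j : Fin K, χ j * χ' j :=
              mul_le_mul_of_nonneg_right h330 hP0
          _ = (Z * Real.exp (-(X / 4))) * ((∏ j : Fin K, χ j * χ' j) * Real.exp (-((∑ j ∈ range (K + 1),
                (γ₀ * (∑ bb ∈ Bk j, t j bb + ∑ x ∈ Ss j, m j x) - E j)) / 4))) := by ring
          _ ≤ (Z * Real.exp (-(X / 4))) * ((∏ j : Fin K, Real.exp (-(γ₀ * r j * (Q j).card / 4))
                * Real.exp (-(γ₀ * r' j * (R j).card / 4))) * Real.exp ((∑ j ∈ range (K + 1), E j) / 4)) :=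
              mul_le_mul_of_nonneg_left h331 (mul_nonneg hZ (Real.exp_pos _).le)
          _ = _ := by ring
    _ = _ := by
        rw [ENNReal.ofReal_mul (mul_nonneg (Real.exp_pos _).le (mul_nonneg hZ (Real.exp_pos _).le)),
          ENNReal.ofReal_mul (Real.exp_pos _).le,
          ENNReal.ofReal_prod_of_nonneg fun j _ => by positivity]

end Pointwise

/-! ## §2  «The expression we get can be estimated in a way similar to (3.22)»: the vector-field integral -/

section VectorFields

variable {V : Type*} [NormedAddCommGroup V] [InnerProductSpace ℝ V] [FiniteDimensional ℝ V]
  [MeasurableSpace V] [BorelSpace V]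
variable {S : ℕ → Type*} [∀ j, Fintype (S j)] [∀ j, DecidableEq (S j)]
variable {K : ℕ} {ι : Fin K → Type*} [∀ j, Fintype (ι j)]

/-- **THE VECTOR-FIELD ANALOGUE OF (3.35)** (p. 591 *"The expression we get can be estimated in a way similar to
(3.22). Now it is even simpler because we do not need the characteristic functions, as it was noticed in Proposition
3.1"*, with the ζ″ of (3.41)): for the schematic right side of the vector-field version of (3.22) — Gaussian
renormalization kernels of precision `a·s_j` with history-dependent centres `c_j` (↤ `(QA_j)(y)`: linear averaging,
no background field), weight `Z e^{−½X(Φ)}` (↤ `Z_vexp(−½⟨Φ_v, Δ_vΦ_v⟩)` of the vector-field (3.25)), the other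
characteristic functions `b ∈ [0,1]`, and per level `j < K` the families `τ` with weights `w_{j,τ}` (↤ the scalar
small factors `e^{−⅛ap²|P_s|}e^{−¼γ₀p²|Q_s|}e^{−p²|R_s|}` of ζ′ (3.34), constants here), bond restrictions `χᶜ_{Q_v⁽ʲ⁾(τ)}`,
site restrictions `χᶜ_{R_v⁽ʲ⁾(τ)}` (both on kept variables) and output-site exceptions `χᶜ_{P_v⁽ʲ⁾(τ)}` — given Prop. 3.1
(3.26) with the mass part site by site on the support of `b` (`h326`; at zero field: no error terms, `E ≡ 0`, and no
restriction), the meaning of the restrictions (`hlarge`, `hlarge'`) and `4N log 2 ≤ a r_j`: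
`(3.22)_v ≤ e^{¼ΣE_k} · ∫dΦ Z e^{−¼X(Φ)} · Π_{j<K} Σ_τ w_{j,τ}·e^{−¼γ₀r_j|Q_v⁽ʲ⁾(τ)|}e^{−¼γ₀r′_j|R_v⁽ʲ⁾(τ)|}·(e^{−⅛ar_j})^{|P_v⁽ʲ⁾(τ)|}`,
i.e. `≤ ∫dΦ_v Z_v e^{−¼⟨Φ_v,Δ_vΦ_v⟩} · Π_{k<K} ζ″_{Λ₀⁽ᵏ⁾}` with **ζ″ = (3.41)** (`r_j = r′_j = p(Lʲε)²`).  `B2Ineq335Printed.ineq335`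
is the case without site restrictions (`R ≡ ∅`, mass part aggregated). [cite: Balaban1982Higgs2, (3.40)–(3.41) pp.591–592] -/
theorem ineq340_core {a : ℝ} (ha : 0 < a) {s : ℕ → ℝ} (hs : ∀ j, 0 < s j)
    {c : (j : ℕ) → ((i : ℕ) → S i → V) → S (j + 1) → V} (hc : ∀ j, Measurable (c j))
    (hcdep : ∀ j i, j + 1 ≤ i → ∀ (x : (i : ℕ) → S i → V) (y : S i → V), c j (update x i y) = c j x)
    {r : ℕ → ℝ} (hr : ∀ j, 4 * (Module.finrank ℝ V : ℝ) * Real.log 2 ≤ a * r j) (r' : ℕ → ℝ)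
    {Z : ℝ} (hZ : 0 ≤ Z) {X : (S 0 → V) → ℝ} (hX : Measurable X)
    {Bnd St : Type*} (Bk : ℕ → Finset Bnd) (Ss : ℕ → Finset St) (t : ℕ → Bnd → (S 0 → V) → ℝ)
    (m : ℕ → St → (S 0 → V) → ℝ) (ht : ∀ j, ∀ bb ∈ Bk j, ∀ u, 0 ≤ t j bb u)
    (hm : ∀ j, ∀ xx ∈ Ss j, ∀ u, 0 ≤ m j xx u) (E : ℕ → ℝ) {γ₀ : ℝ} (hγ : 0 ≤ γ₀)
    {b : ((i : ℕ) → S i → V) → ℝ} (hb : ∀ x, 0 ≤ b x ∧ b x ≤ 1)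
    (h326 : ∀ x, b x ≠ 0 →
      (∑ j ∈ range (K + 1), (γ₀ * (∑ bb ∈ Bk j, t j bb (x 0) + ∑ xx ∈ Ss j, m j xx (x 0)) - E j)) ≤ X (x 0))
    (w : (j : Fin K) → ι j → ℝ≥0∞) (Q : (j : Fin K) → ι j → Finset Bnd) (hQ : ∀ j τ, Q j τ ⊆ Bk j)
    (R : (j : Fin K) → ι j → Finset St) (hR : ∀ j τ, R j τ ⊆ Ss j)
    (P : (j : Fin K) → ι j → Finset (S (j + 1)))
    (χQ χR : (j : Fin K) → ι j → (S 0 → V) → ℝ) (hχQ : ∀ j τ u, χQ j τ u = 0 ∨ χQ j τ u = 1)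
    (hχR : ∀ j τ u, χR j τ u = 0 ∨ χR j τ u = 1)
    (hlarge : ∀ j τ u, χQ j τ u = 1 → ∀ bb ∈ Q j τ, r j < t j bb u)
    (hlarge' : ∀ j τ u, χR j τ u = 1 → ∀ xx ∈ R j τ, r' j < m j xx u)
    (x : (i : ℕ) → S i → V) :
    rhs322 (fun i => (volume : Measure (S i → V)))
        (fun u => ENNReal.ofReal (Z * Real.exp (-(X u / 2)))) (fun x => ENNReal.ofReal (b x))
        (gaussLevel (fun j _ => a * s j) c) w (fun j τ u => ENNReal.ofReal (χQ j τ u * χR j τ u))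
        (fun j τ => excLevel c j (largeFieldSite (P j τ) (s j) (r j))) x
      ≤ ENNReal.ofReal (Real.exp ((∑ j ∈ range (K + 1), E j) / 4))
        * (∫⁻ u, ENNReal.ofReal (Z * Real.exp (-(X u / 4))))
        * ∏ j : Fin K, ∑ τ : ι j, w j τ
            * ENNReal.ofReal (Real.exp (-(γ₀ * r j * (Q j τ).card / 4))
                * Real.exp (-(γ₀ * r' j * (R j τ).card / 4)))
            * ENNReal.ofReal (Real.exp (-(a * r j / 8)) ^ (P j τ).card) := by
  refine rhs322_le (μ := fun i => (volume : Measure (S i → V)))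
    (F := fun u => ENNReal.ofReal (Z * Real.exp (-(X u / 2))))
    (σ := fun j τ => ENNReal.ofReal (Real.exp (-(γ₀ * r j * (Q j τ).card / 4))
      * Real.exp (-(γ₀ * r' j * (R j τ).card / 4))))
    (θ := fun j τ => ENNReal.ofReal (Real.exp (-(a * r j / 8)) ^ (P j τ).card))
    ?_ (fun j => ?_) (fun j i hji x y => ?_) ?_ ?_ ?_ ?_ x
  · exact ENNReal.measurable_ofReal.comp (measurable_const.mul ((hX.div_const 4).neg.exp))
  · -- measurability of r14's level kernels (re-derived: the lemma is private upstream)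
    unfold gaussLevel
    refine ENNReal.measurable_ofReal.comp (Finset.measurable_prod _ fun y _ => ?_)
    exact (B1RT.continuous_rtKernel _).measurable.comp
      (((measurable_pi_apply y).comp (measurable_pi_apply (j + 1))).sub ((measurable_pi_apply y).comp (hc j)))
  · unfold gaussLevel
    rw [Function.update_of_ne (by omega : j + 1 ≠ i), hcdep j i hji.le x y]
  · intro j τ
    unfold excLevel
    refine ENNReal.measurable_ofReal.comp (Finset.measurable_prod _ fun y _ => ?_)
    have hχm : Measurable (largeFieldSite (V := V) (P j τ) (s j) (r j) y) := by
      unfold largeFieldSite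
      by_cases hy : y ∈ P j τ
      · simp only [hy, if_true]
        refine Measurable.ite ?_ measurable_const measurable_const
        exact measurableSet_lt measurable_const
          (measurable_const.mul (continuous_norm.measurable.pow_const 2))
      · simp only [hy, if_false]
        exact measurable_const
    exact hχm.comp (((measurable_pi_apply y).comp (measurable_pi_apply ((j : ℕ) + 1))).sub
      ((measurable_pi_apply y).comp (hc j)))
  · intro j τ i hji x y
    unfold excLevel
    rw [Function.update_of_ne (by omega : (j : ℕ) + 1 ≠ i), hcdep j i hji.le x y]
  · exact fun j τ x => lintegral_gaussLevel_mul_excLevel_printed_le ha hs hcdep hr j (P j τ) x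
  · intro τ x
    exact pointwise340 Bk Ss (fun j bb => t j bb (x 0)) (fun j xx => m j xx (x 0))
      (fun j bb hbb => ht j bb hbb (x 0)) (fun j xx hxx => hm j xx hxx (x 0)) E hγ r r'
      (fun j => Q j (τ j)) (fun j => hQ j (τ j)) (fun j => R j (τ j)) (fun j => hR j (τ j))
      (fun j => χQ j (τ j) (x 0)) (fun j => χR j (τ j) (x 0)) (fun j => hχQ j (τ j) (x 0))
      (fun j => hχR j (τ j) (x 0)) (fun j => hlarge j (τ j) (x 0)) (fun j => hlarge' j (τ j) (x 0)) hZ (hb x)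
      (h326 x)

end VectorFields

/-! ## §3  (3.40): the bookkeeping «(3.21) with {…} ≤ (3.39)» → ζ″, exp(E₀), exp(O(1)Σ|Λ_k|), exp(O(1)|T_ε|) -/

/-- **(3.40)** p. 591 *"Using the above inequality we estimate the right side of (3.21) by an expression in which the
curly bracket {…} is replaced by the right side of (3.39). The expression we get can be estimated in a way similar to
(3.22). … We get the inequality ∫dB∫dψ ρ^{(K),L^Kε}(Λ₀⁽⁰⁾, …, Λ₀⁽ᴷ⁻¹⁾, B, B^{(K),ε}, ψ) ≦ Π_{k=0}^{K−1} ζ″_{Λ₀⁽ᵏ⁾} exp(E₀)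
exp(O(1)Σ_{k=1}^{K}|Λ_k|) exp(O(1)|T_ε|), (3.40)"* AS BOOKKEEPING with the printed `O(1)`'s explicit.  Inputs, in the
reals of one cutoff: (3.21) `lhs ≤ I_v·e^{s₂₁}` (`I_v` ↤ the vector-field integral of (3.21) with the curly bracket,
`s₂₁ = Σ_{k=1}^{K}O(1)(Lᵏε)^{κ₀}|T_ε| ≤ C₁|T_ε|` by (2.118): `h2118`); (3.39) under the vector-field integral
`I_v ≤ e^{E_{0,s}}·e^{c₃₉Σ_{k=0}^{K}|Λ_k|}·J_v` (`J_v` ↤ the integral with `{…}` replaced by `Π_kζ′_{Λ₀⁽ᵏ⁾}`, the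
constants of (3.39) pulled out: `h339`); the vector-field (3.35) `J_v ≤ I₄·Z″` (`ineq340_core` at zero field: `I₄` ↤
`∫dΦ_vZ_ve^{−¼⟨Φ_v,Δ_vΦ_v⟩}`, `Z″ = Π_kζ″_{Λ₀⁽ᵏ⁾} ≥ 0`: `h335v`); (3.36)–(3.38) for the vector fields `I₄ = e^{c₂Σ_{k=0}^{K}|Λ_k|}·
e^{E_{0,v}}` (the Jacobian of `Φ = √2Φ′` and the free vector-field Gaussian integral, an EQUALITY at zero field:
`h3368v`); `|Λ₀| ≤ |T_ε|` (`Λ₀ := Λ₅⁽⁰⁾ᶜ ⊂ T_ε`: `hvol0`).  Conclusion: `lhs ≤ Z″·e^{E_{0,s}+E_{0,v}}·e^{(c₃₉+c₂)Σ_{k=1}^{K}|Λ_k|}·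
e^{(C₁+|c₃₉|+|c₂|)|T_ε|}` — (3.40) with `E₀ = E_{0,s} + E_{0,v}`, `O(1) = c₃₉ + c₂` resp. `C₁ + |c₃₉| + |c₂|`.
[cite: Balaban1982Higgs2, (3.40) p.591, (3.21) p.588, (3.39) p.591, (2.118) p.582 (bookkeeping; explicit O(1))] -/
theorem ineq340_of_321_339 {lhs Iv Jv I₄ Zpp E0s E0v s₂₁ C₁ c₃₉ c₂ T : ℝ} {K : ℕ} {vol : ℕ → ℝ}
    (hZpp : 0 ≤ Zpp) (hvol : ∀ k, 0 ≤ vol k) (hvol0 : vol 0 ≤ T)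
    (h321 : lhs ≤ Iv * Real.exp s₂₁) (h2118 : s₂₁ ≤ C₁ * T)
    (h339 : Iv ≤ Real.exp E0s * Real.exp (c₃₉ * ∑ k ∈ range (K + 1), vol k) * Jv)
    (h335v : Jv ≤ I₄ * Zpp)
    (h3368v : I₄ = Real.exp (c₂ * ∑ k ∈ range (K + 1), vol k) * Real.exp E0v) :
    lhs ≤ Zpp * Real.exp (E0s + E0v) * Real.exp ((c₃₉ + c₂) * ∑ k ∈ Icc 1 K, vol k)
      * Real.exp ((C₁ + |c₃₉| + |c₂|) * T) := by
  -- split the volume sum: Σ_{k=0}^{K} = vol 0 + Σ_{k=1}^{K}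
  have hsplit : ∑ k ∈ range (K + 1), vol k = vol 0 + ∑ k ∈ Icc 1 K, vol k := by
    rw [Finset.range_eq_Ico, Finset.sum_eq_sum_Ico_succ_bot (Nat.succ_pos K)]
    simp only [Nat.succ_eq_add_one, zero_add, Finset.Ico_add_one_right_eq_Icc]
  set W : ℝ := ∑ k ∈ Icc 1 K, vol k with hW
  have hW0 : 0 ≤ W := Finset.sum_nonneg fun k _ => hvol k
  have hT0 : 0 ≤ T := (hvol 0).trans hvol0
  -- chain the hypotheses
  have hJ : Jv ≤ Real.exp (c₂ * (vol 0 + W)) * Real.exp E0v * Zpp := by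
    rw [← hsplit, ← h3368v]; exact h335v
  have h39' : Iv ≤ Real.exp E0s * Real.exp (c₃₉ * (vol 0 + W)) * (Real.exp (c₂ * (vol 0 + W)) * Real.exp E0v * Zpp) := by
    rw [← hsplit]
    exact h339.trans (mul_le_mul_of_nonneg_left (hsplit ▸ hJ) (by positivity))
  have hlhs : lhs ≤ Real.exp E0s * Real.exp (c₃₉ * (vol 0 + W))
      * (Real.exp (c₂ * (vol 0 + W)) * Real.exp E0v * Zpp) * Real.exp (C₁ * T) :=
    h321.trans (mul_le_mul (h39') (Real.exp_le_exp.2 h2118) (Real.exp_pos _).le (by positivity))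
  -- absorb the k = 0 volume into the |T_ε| term: c·vol 0 ≤ |c|·T
  have h0a : c₃₉ * vol 0 ≤ |c₃₉| * T :=
    (le_abs_self _).trans (by rw [abs_mul, abs_of_nonneg (hvol 0)]; exact mul_le_mul_of_nonneg_left hvol0 (abs_nonneg _))
  have h0b : c₂ * vol 0 ≤ |c₂| * T :=
    (le_abs_self _).trans (by rw [abs_mul, abs_of_nonneg (hvol 0)]; exact mul_le_mul_of_nonneg_left hvol0 (abs_nonneg _))
  have hexp : Real.exp E0s * Real.exp (c₃₉ * (vol 0 + W)) * (Real.exp (c₂ * (vol 0 + W)) * Real.exp E0v * Zpp)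
      * Real.exp (C₁ * T)
      = Zpp * Real.exp (E0s + E0v) * Real.exp ((c₃₉ + c₂) * W) * Real.exp (c₃₉ * vol 0 + c₂ * vol 0 + C₁ * T) := by
    simp only [Real.exp_add, mul_add, add_mul]
    ring
  rw [hexp] at hlhs
  refine hlhs.trans ?_
  have hlast : Real.exp (c₃₉ * vol 0 + c₂ * vol 0 + C₁ * T) ≤ Real.exp ((C₁ + |c₃₉| + |c₂|) * T) :=
    Real.exp_le_exp.2 (by nlinarith)
  exact mul_le_mul_of_nonneg_left hlast (by positivity)

end Literature.MathematicalPhysics.QuantumFieldTheory.Balaban1983to89.B2Ineq340VectorFields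

end
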